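import Mathlib
import HarnessLib
import Summits.HubbardSuperconductivity.HubbardSuperconductivity.Theorems.KLProgrammeKLRegimeEngineTowerBookkeepingProfile

/-!
# Route `KLProgramme` — crux K3 ENGINE (stmt-HubbardSuperconductivity-20437 `KLRegimeEngineV17F2`), stub (b) v2, THE LEVELS PACKAGE (ℓ):
# the blocked-tower bookkeeping, part 9″-Z — THE TRACK INDUCTION IN PROFILE FORM CARRYING A TOKEN ALONG THE BLOCKS («(ℓ)-Z-THREAD»;
# located item #18 «(Z)-EXPORT», pen (R87), p5 g13 `Z-UNITS.md` §2; cell gate-hubbard-kl, seat hubbard-kl-k3c3-p2 g16)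

WHY.  Every block step of the (ℓ) tower (`klTowerBLevF_succ_le_kitStep[_of_bounds]`, the LINK) needs the partition function of the tower's frame to be a unit
at the block's INPUT scale, `Z^K_{Λ_{dk}} ≠ 0` (semigroup `klTowerIncr_eq_effAction_sub`, `constPart 𝒱_{dk} = 0`).  That fact is not available from the history:
it is the induction's own invariant — `Z^K_{Λ_{dk}} ≠ 0` and the block-`k` door smallness (which the induction derives from its hypothesis at block `k`) give
`IsUnit ∫dμ_{Γ_k} e^{−𝒱_{dk}}` (p5 g13 `isUnit_effPartitionFn_blockStep_lev`), hence `Z^K_{Λ_{d(k+1)}} ≠ 0`.  A law that takes `∀ k < K_b, Z^K_{Λ_{dk}} ≠ 0` as a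
blanket hypothesis is therefore not dischargeable by any consumer.  This file re-states p4 g18's track induction `towerBorn_le_law_tracks_of_profile` (T3-P) with
an ABSTRACT TOKEN `Zk : ℕ → Prop` carried along the blocks:

* **`towerBorn_le_law_tracks_of_profile_tok`** — T3-P verbatim, plus `hZ0 : Zk 0`, `hZsucc : ∀ k < K, Zk k → Φ·towerV D τ (μ k) < 1 → Zk (k+1)` (the token
  propagates under EXACTLY the guard the induction hands to the step), the step hypothesis weakened to `… → Zk k → …`, and `3 ≤ D`;
  conclusion `∀ k ≤ K, Zk k ∧ (the law at block k)`.  Proof = p4 g18's induction with the invariant strengthened by `Zk k`; the guard at block `k` is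
  `Φ·towerV D τ (μ k) ≤ Φ·Θ < 1` (`towerV_le_fourPiece` + `hθ`).
* **`towerBorn_le_law_tracks_of_profile_base_tok`** — the re-based twin (blocks `1 ≤ k`, as `towerBorn_le_law_tracks_of_profile_base` of …TowerLevLawBase §1):
  `hZ1 : Zk 1`, conclusion `(∀ k, 1 ≤ k → k ≤ K → Zk k) ∧ (the law at every block 2 ≤ k ≤ K)`.
At `Zk := fun _ => True` both reduce to the originals.  The model files instantiate `Zk k := (hubbardEffPartitionFnCT … K (klScale klE0 (d·k)) ≠ 0)` and discharge
`hZsucc` by `hubbardEffPartitionFnCT_klScale_block_succ_ne_zero_of_kitGuard` (…TowerLevZUnitOfKitGuard).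
Pure real analysis; nothing about the model is asserted; nothing asserts any stub, (ℓ), K3 or superconductivity.
References: Benfatto–Giuliani–Mastropietro 2006 §2.8 (2.83), (2.93)–(2.98), §2.3 (2.13)–(2.14) [cite: BenfattoGiulianiMastropietro2006]; Gawȩdzki–Kupiainen 1985 §3.
-/

noncomputable section

namespace Summit.HubbardSuperconductivity.HubbardSuperconductivity.Theorems.EngineV8

set_option linter.dupNamespace false -- summit = problem name (single-conjunct summit), D-0017

open Real Finset

/-! ## §1 T3-P carrying a token -/

/-- **(T3-P-Z) The blocked birth-level tower with finitely many tracks, PROFILE FORM, CARRYING A TOKEN ALONG THE BLOCKS.**  As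
`towerBorn_le_law_tracks_of_profile`, with an abstract predicate `Zk : ℕ → Prop` on the block boundaries: `Zk 0` holds, `Zk k` together with the step's own guard
`Φ·towerV D τ (μ k) < 1` gives `Zk (k+1)`, and the step hypothesis at block `k` may use `Zk k`.  Conclusion: `Zk k` AND the law `b t k p ≤ Aλ^{p−1}Q^p` at every
boundary `k ≤ K`.  (In the model `Zk k` is «the partition function of the tower's frame is a unit at `Λ_{dk}`».) [cite: BenfattoGiulianiMastropietro2006, §2.8 (2.83), (2.93)-(2.98)] -/
theorem towerBorn_le_law_tracks_of_profile_tok {T : Type*} {D K : ℕ} {b : T → ℕ → ℕ → ℝ} {μ : ℕ → ℕ → ℝ}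
    {A lam Q σ Φ ψ τ A' Q' ι₁ ι₂ ι₃ : ℝ} {Zk : ℕ → Prop}
    (hD3 : 3 ≤ D) (hlam : 0 < lam) (hQ : 0 ≤ Q)
    (hσ : 0 ≤ σ) (hΦ : 0 ≤ Φ) (hψ : 0 ≤ ψ) (hτ : 0 < τ) (hQ'0 : 0 < Q') (hA'0 : 0 ≤ A')
    (hμ0 : ∀ k m, 0 ≤ μ k m)
    (h0 : ∀ t p, 3 ≤ p → p ≤ D → b t 0 p ≤ A * lam ^ (p - 1) * Q ^ p)
    (hZ0 : Zk 0) (hZsucc : ∀ k < K, Zk k → Φ * towerV D τ (μ k) < 1 → Zk (k + 1))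
    (hprof : ∀ k < K, (∀ k' ≤ k, ∀ t, ∀ p, 3 ≤ p → p ≤ D → b t k' p ≤ A * lam ^ (p - 1) * Q ^ p) →
      ∀ m, 4 ≤ m → m ≤ D → μ k m ≤ A' * lam ^ (m - 1) * Q' ^ m)
    (hprof3 : ∀ k < K, 3 ≤ D → (∀ k' ≤ k, ∀ t, ∀ p, 3 ≤ p → p ≤ D → b t k' p ≤ A * lam ^ (p - 1) * Q ^ p) →
      μ k 3 ≤ ι₃ * lam ^ 2)
    (hι₁ : ∀ k < K, μ k 1 ≤ ι₁ * lam) (hι₂ : ∀ k < K, μ k 2 ≤ ι₂ * lam)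
    (hstep : ∀ t, ∀ k < K, Zk k → ∀ N : ℕ, 2 ≤ N → ∀ p, 3 ≤ p → p ≤ D → Φ * towerV D τ (μ k) < 1 →
      b t (k + 1) p ≤ towerFO D σ (μ k) p + ∑ n ∈ Icc 2 N, exp 1 * Φ ^ (n - 1) * ψ ^ p * towerS D τ (μ k) n p +
        ψ ^ p * exp 1 * towerV D τ (μ k) * (Φ * towerV D τ (μ k)) ^ N / (1 - Φ * towerV D τ (μ k)))
    (hx₁ : 4 * σ * lam * Q' < 1) (hx₂ : 2 * lam * τ * Q' ≤ 1) (hx₃ : exp 1 * τ * lam * Q' < 1)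
    (hy : Φ * (τ * (ι₁ * lam + ι₂ / (2 * Q') + ι₃ / (4 * Q' ^ 2) + A' * Q' / 4)) < 1)
    (hθ : Φ * (exp 1 * τ * (ι₁ * lam) + (exp 1 * τ) ^ 2 * (ι₂ * lam) + (exp 1 * τ) ^ 3 * (ι₃ * lam ^ 2) +
      A' * (exp 1 * τ * Q') * ((exp 1 * τ * lam * Q') ^ 3 / (1 - exp 1 * τ * lam * Q'))) < 1)
    (hu₁ : 4 * Q' ≤ Q) (hu₂ : 2 * τ * ψ * Q' ≤ Q)
    (hclose : A' * (4 * Q') ^ 3 * (4 * σ * lam * Q' / (1 - 4 * σ * lam * Q')) +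
      exp 1 * ψ * (2 * τ * ψ * Q') ^ 2 * (τ * (ι₁ * lam + ι₂ / (2 * Q') + ι₃ / (4 * Q' ^ 2) + A' * Q' / 4)) *
        (Φ * (τ * (ι₁ * lam + ι₂ / (2 * Q') + ι₃ / (4 * Q' ^ 2) + A' * Q' / 4)) /
          (1 - Φ * (τ * (ι₁ * lam + ι₂ / (2 * Q') + ι₃ / (4 * Q' ^ 2) + A' * Q' / 4)))) ≤ A * Q ^ 3) :
    ∀ k ≤ K, Zk k ∧ ∀ t, ∀ p, 3 ≤ p → p ≤ D → b t k p ≤ A * lam ^ (p - 1) * Q ^ p := by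
  have hx10 : 0 ≤ 4 * σ * lam * Q' / (1 - 4 * σ * lam * Q') := div_nonneg (by positivity) (sub_nonneg.2 hx₁.le)
  have hw : 1 ≤ (2 * τ * Q' * lam)⁻¹ := (one_le_inv₀ (by positivity)).2 (by linarith)
  set Y := ι₁ * lam + ι₂ / (2 * Q') + ι₃ / (4 * Q' ^ 2) + A' * Q' / 4 with hY
  suffices H : ∀ k ≤ K, Zk k ∧ ∀ k' ≤ k, ∀ t, ∀ p, 3 ≤ p → p ≤ D → b t k' p ≤ A * lam ^ (p - 1) * Q ^ p from
    fun k hk => ⟨(H k hk).1, fun t p hp hpD => (H k hk).2 k le_rfl t p hp hpD⟩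
  intro k
  induction k with
  | zero =>
    intro _
    exact ⟨hZ0, fun k' hk' t p hp hpD => by rw [Nat.le_zero.1 hk']; exact h0 t p hp hpD⟩
  | succ k ih =>
    intro hk1
    have hkK : k < K := Nat.lt_of_succ_le hk1
    obtain ⟨hZk, ih'⟩ := ih (Nat.le_of_succ_le hk1)
    -- the measured profile and the six-leg import at block `k`, from the law on all earlier blocks
    have hIH : ∀ k'' ≤ k, ∀ t, ∀ p, 3 ≤ p → p ≤ D → b t k'' p ≤ A * lam ^ (p - 1) * Q ^ p :=
      fun k'' hk'' t p hp hpD => ih' k'' hk'' t p hp hpD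
    have hprof' : ∀ m, 4 ≤ m → m ≤ D → μ k m ≤ A' * lam ^ (m - 1) * Q' ^ m := hprof k hkK hIH
    have hμ3' : μ k 3 ≤ ι₃ * lam ^ 2 := hprof3 k hkK hD3 hIH
    -- Chernoff data
    have hG := sum_fourPiece_le (D := D) hτ hlam hQ'0 hA'0 (hμ0 k) (hι₁ k hkK) (hι₂ k hkK) hμ3' hprof'
    have hG0 : 0 ≤ τ * Y := (sum_nonneg fun δ _ => by have := hμ0 k δ; positivity).trans hG
    have hY0' : 0 ≤ Y := (mul_nonneg_iff_of_pos_left hτ).1 hG0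
    have hVb := towerV_le_fourPiece hτ.le hlam.le hQ'0.le hA'0 (hμ0 k) (hι₁ k hkK) (hι₂ k hkK) hμ3' hprof' hx₃
    -- the guard at block `k` (the same number the step receives), hence the token at `k + 1`
    have hguard : Φ * towerV D τ (μ k) < 1 := lt_of_le_of_lt (mul_le_mul_of_nonneg_left hVb hΦ) hθ
    refine ⟨hZsucc k hkK hZk hguard, ?_⟩
    intro k' hk' t p hp hpD
    rcases Nat.lt_succ_iff_lt_or_eq.1 (Nat.lt_succ_of_le hk') with hlt | rfl
    · exact ih' k' (Nat.lt_succ_iff.1 hlt) t p hp hpD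
    · -- the closing computation, for any born size obeying the step hypothesis with these Chernoff data
      have hclose' : ∀ x : ℝ, (∀ N : ℕ, 2 ≤ N → Φ * towerV D τ (μ k) < 1 →
          x ≤ towerFO D σ (μ k) (3 + (p - 3)) + ∑ n ∈ Icc 2 N, exp 1 * Φ ^ (n - 1) * ψ ^ (3 + (p - 3)) * towerS D τ (μ k) n (3 + (p - 3)) +
            ψ ^ (3 + (p - 3)) * exp 1 * towerV D τ (μ k) * (Φ * towerV D τ (μ k)) ^ N / (1 - Φ * towerV D τ (μ k))) →
          x ≤ A * lam ^ (3 + (p - 3) - 1) * Q ^ (3 + (p - 3)) := by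
        intro x hx
        have hT2 := towerStep_le_of_chernoff (D := D) hΦ hψ hτ.le (hμ0 k) hw
          (towerFO_le_of_four_le hσ hA'0 hlam.le hQ'0.le (hμ0 k) hprof' hx₁ (p := 3 + (p - 3)) (by omega) (D := D)) hG hVb hy hθ hx
        refine hT2.trans ?_
        have hinv : (((2 * τ * Q' * lam)⁻¹) ^ (3 + (p - 3) - 1))⁻¹ = (2 * τ * Q' * lam) ^ (3 + (p - 3) - 1) := by rw [inv_pow, inv_inv]
        rw [hinv]
        have hyq0 : 0 ≤ Φ * (τ * Y) / (1 - Φ * (τ * Y)) := div_nonneg (by positivity) (sub_nonneg.2 hy.le)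
        set rr := p - 3 with hrr
        have h4 : (4 * Q') ^ (3 + rr) ≤ (4 * Q') ^ 3 * Q ^ rr := by
          rw [pow_add]; exact mul_le_mul_of_nonneg_left (pow_le_pow_left₀ (by positivity) hu₁ rr) (by positivity)
        have h2 : ψ ^ (3 + rr) * (2 * τ * Q' * lam) ^ (3 + rr - 1) ≤ lam ^ (3 + rr - 1) * ψ * ((2 * τ * ψ * Q') ^ 2 * Q ^ rr) := by
          have heq : ψ ^ (3 + rr) * (2 * τ * Q' * lam) ^ (3 + rr - 1) = lam ^ (3 + rr - 1) * ψ * ((2 * τ * ψ * Q') ^ 2 * (2 * τ * ψ * Q') ^ rr) := by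
            rw [show 3 + rr - 1 = rr + 2 by omega, show 3 + rr = rr + 2 + 1 by omega]
            ring
          rw [heq]
          have hr' : (2 * τ * ψ * Q') ^ rr ≤ Q ^ rr := pow_le_pow_left₀ (by positivity) hu₂ rr
          exact mul_le_mul_of_nonneg_left (mul_le_mul_of_nonneg_left hr' (by positivity)) (by positivity)
        set X₁ := 4 * σ * lam * Q' / (1 - 4 * σ * lam * Q') with hX₁
        set Z := Φ * (τ * Y) / (1 - Φ * (τ * Y)) with hZ
        calc A' * lam ^ (3 + rr - 1) * (4 * Q') ^ (3 + rr) * X₁ + exp 1 * ψ ^ (3 + rr) * (2 * τ * Q' * lam) ^ (3 + rr - 1) * (τ * Y) * Z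
            ≤ A' * lam ^ (3 + rr - 1) * ((4 * Q') ^ 3 * Q ^ rr) * X₁ +
                exp 1 * (lam ^ (3 + rr - 1) * ψ * ((2 * τ * ψ * Q') ^ 2 * Q ^ rr)) * (τ * Y) * Z := by
              have : exp 1 * ψ ^ (3 + rr) * (2 * τ * Q' * lam) ^ (3 + rr - 1) = exp 1 * (ψ ^ (3 + rr) * (2 * τ * Q' * lam) ^ (3 + rr - 1)) := by
                ring
              rw [this]
              gcongr
          _ = lam ^ (3 + rr - 1) * Q ^ rr * (A' * (4 * Q') ^ 3 * X₁ + exp 1 * ψ * (2 * τ * ψ * Q') ^ 2 * (τ * Y) * Z) := by ring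
          _ ≤ lam ^ (3 + rr - 1) * Q ^ rr * (A * Q ^ 3) := mul_le_mul_of_nonneg_left hclose (by positivity)
          _ = A * lam ^ (3 + rr - 1) * Q ^ (3 + rr) := by rw [pow_add]; ring
      have hp3 : p = 3 + (p - 3) := by omega
      have hfin := hclose' (b t (k + 1) p) (fun N hN hg => by rw [← hp3]; exact hstep t k hkK hZk N hN p hp hpD hg)
      rwa [← hp3] at hfin

/-! ## §2 The re-based twin (blocks `1 ≤ k`) -/

/-- **The track induction from a base block, CARRYING A TOKEN** (re-based twin of `towerBorn_le_law_tracks_of_profile_tok`; compare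
`towerBorn_le_law_tracks_of_profile_base`, …TowerLevLawBase §1): hypotheses at blocks `1 ≤ k < K` only, `Zk 1` at the base block, the token propagated by
`hZsucc` under the step's guard, the step at block `k` may use `Zk k`; conclusion: `Zk k` at every block `1 ≤ k ≤ K` and the law at every block `2 ≤ k ≤ K`.
[cite: BenfattoGiulianiMastropietro2006, §2.8 (2.93)-(2.98)] -/
theorem towerBorn_le_law_tracks_of_profile_base_tok {T : Type*} {D K : ℕ} {b : T → ℕ → ℕ → ℝ} {μ : ℕ → ℕ → ℝ}
    {A lam Q σ Φ ψ τ A' Q' ι₁ ι₂ ι₃ : ℝ} {Zk : ℕ → Prop}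
    (hD3 : 3 ≤ D) (hlam : 0 < lam) (hA : 0 ≤ A) (hQ : 0 ≤ Q)
    (hσ : 0 ≤ σ) (hΦ : 0 ≤ Φ) (hψ : 0 ≤ ψ) (hτ : 0 < τ) (hQ'0 : 0 < Q') (hA'0 : 0 ≤ A')
    (hμ0 : ∀ k, 1 ≤ k → ∀ m, 0 ≤ μ k m)
    (hZ1 : Zk 1) (hZsucc : ∀ k, 1 ≤ k → k < K → Zk k → Φ * towerV D τ (μ k) < 1 → Zk (k + 1))
    (hprof : ∀ k, 1 ≤ k → k < K → (∀ k', 2 ≤ k' → k' ≤ k → ∀ t, ∀ p, 3 ≤ p → p ≤ D → b t k' p ≤ A * lam ^ (p - 1) * Q ^ p) →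
      ∀ m, 4 ≤ m → m ≤ D → μ k m ≤ A' * lam ^ (m - 1) * Q' ^ m)
    (hprof3 : ∀ k, 1 ≤ k → k < K → 3 ≤ D →
      (∀ k', 2 ≤ k' → k' ≤ k → ∀ t, ∀ p, 3 ≤ p → p ≤ D → b t k' p ≤ A * lam ^ (p - 1) * Q ^ p) → μ k 3 ≤ ι₃ * lam ^ 2)
    (hι₁ : ∀ k, 1 ≤ k → k < K → μ k 1 ≤ ι₁ * lam) (hι₂ : ∀ k, 1 ≤ k → k < K → μ k 2 ≤ ι₂ * lam)
    (hstep : ∀ t, ∀ k, 1 ≤ k → k < K → Zk k → ∀ N : ℕ, 2 ≤ N → ∀ p, 3 ≤ p → p ≤ D → Φ * towerV D τ (μ k) < 1 →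
      b t (k + 1) p ≤ towerFO D σ (μ k) p + ∑ n ∈ Icc 2 N, exp 1 * Φ ^ (n - 1) * ψ ^ p * towerS D τ (μ k) n p +
        ψ ^ p * exp 1 * towerV D τ (μ k) * (Φ * towerV D τ (μ k)) ^ N / (1 - Φ * towerV D τ (μ k)))
    (hx₁ : 4 * σ * lam * Q' < 1) (hx₂ : 2 * lam * τ * Q' ≤ 1) (hx₃ : exp 1 * τ * lam * Q' < 1)
    (hy : Φ * (τ * (ι₁ * lam + ι₂ / (2 * Q') + ι₃ / (4 * Q' ^ 2) + A' * Q' / 4)) < 1)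
    (hθ : Φ * (exp 1 * τ * (ι₁ * lam) + (exp 1 * τ) ^ 2 * (ι₂ * lam) + (exp 1 * τ) ^ 3 * (ι₃ * lam ^ 2) +
      A' * (exp 1 * τ * Q') * ((exp 1 * τ * lam * Q') ^ 3 / (1 - exp 1 * τ * lam * Q'))) < 1)
    (hu₁ : 4 * Q' ≤ Q) (hu₂ : 2 * τ * ψ * Q' ≤ Q)
    (hclose : A' * (4 * Q') ^ 3 * (4 * σ * lam * Q' / (1 - 4 * σ * lam * Q')) +
      exp 1 * ψ * (2 * τ * ψ * Q') ^ 2 * (τ * (ι₁ * lam + ι₂ / (2 * Q') + ι₃ / (4 * Q' ^ 2) + A' * Q' / 4)) *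
        (Φ * (τ * (ι₁ * lam + ι₂ / (2 * Q') + ι₃ / (4 * Q' ^ 2) + A' * Q' / 4)) /
          (1 - Φ * (τ * (ι₁ * lam + ι₂ / (2 * Q') + ι₃ / (4 * Q' ^ 2) + A' * Q' / 4)))) ≤ A * Q ^ 3) :
    (∀ k, 1 ≤ k → k ≤ K → Zk k) ∧
      ∀ k, 2 ≤ k → k ≤ K → ∀ t, ∀ p, 3 ≤ p → p ≤ D → b t k p ≤ A * lam ^ (p - 1) * Q ^ p := by
  -- the tokenised law for the shifted arrays `j ↦ block j + 1`, with a zero virtual born array at `j = 0` and the shifted token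
  have key : ∀ j ≤ K - 1, (fun j => Zk (j + 1)) j ∧ ∀ t, ∀ p, 3 ≤ p → p ≤ D →
      (fun (t : T) (j p : ℕ) => if j = 0 then (0 : ℝ) else b t (j + 1) p) t j p ≤ A * lam ^ (p - 1) * Q ^ p := by
    refine towerBorn_le_law_tracks_of_profile_tok (b := fun (t : T) (j p : ℕ) => if j = 0 then (0 : ℝ) else b t (j + 1) p)
      (μ := fun j m => μ (j + 1) m) (Zk := fun j => Zk (j + 1)) hD3 hlam hQ hσ hΦ hψ hτ hQ'0 hA'0 (fun j m => hμ0 (j + 1) (Nat.succ_pos j) m)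
      ?_ hZ1 ?_ ?_ ?_ ?_ ?_ ?_ hx₁ hx₂ hx₃ hy hθ hu₁ hu₂ hclose
    · -- `h0`: the virtual born array at `j = 0`
      intro t p _ _
      simp only [if_true]
      positivity
    · -- the token at `j + 1` from the token and the guard at block `j + 1`
      intro j hj hZj hg
      exact hZsucc (j + 1) (Nat.succ_pos j) (by omega) hZj hg
    · -- `hprof` at `j` from the re-based profile at block `j + 1`
      intro j hj ih m hm hmD
      refine hprof (j + 1) (Nat.succ_pos j) (by omega) (fun k' hk'2 hk'le t p hp hpD => ?_) m hm hmD
      have h := ih (k' - 1) (by omega) t p hp hpD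
      have hk' : k' - 1 ≠ 0 := by omega
      simp only [hk', if_false] at h
      rwa [show k' - 1 + 1 = k' by omega] at h
    · -- `hprof3` likewise
      intro j hj hD3' ih
      refine hprof3 (j + 1) (Nat.succ_pos j) (by omega) hD3' (fun k' hk'2 hk'le t p hp hpD => ?_)
      have h := ih (k' - 1) (by omega) t p hp hpD
      have hk' : k' - 1 ≠ 0 := by omega
      simp only [hk', if_false] at h
      rwa [show k' - 1 + 1 = k' by omega] at h
    · intro j hj
      exact hι₁ (j + 1) (Nat.succ_pos j) (by omega)
    · intro j hj
      exact hι₂ (j + 1) (Nat.succ_pos j) (by omega)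
    · -- `hstep` at `j` is the step over block `j + 1`, which may use the token at `j + 1`
      intro t j hj hZj N hN p hp hpD hg
      simp only [Nat.succ_ne_zero, if_false]
      exact hstep t (j + 1) (Nat.succ_pos j) (by omega) hZj N hN p hp hpD hg
  refine ⟨fun k hk1 hkK => ?_, fun k hk2 hkK t p hp hpD => ?_⟩
  · have h := (key (k - 1) (by omega)).1
    simp only at h
    rwa [show k - 1 + 1 = k by omega] at h
  · have h := (key (k - 1) (by omega)).2 t p hp hpD
    have hk1 : k - 1 ≠ 0 := by omega
    simp only [hk1, if_false] at h
    rwa [show k - 1 + 1 = k by omega] at h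

end Summit.HubbardSuperconductivity.HubbardSuperconductivity.Theorems.EngineV8

end
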